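/-
Copyright (c) 2026. All rights reserved.
Released under Apache 2.0 license as described in the file LICENSE.
Authors: abc-iut cell — seat abc-iut-L4-t8 (gen 9; proof-only companion of `HolomorphicCores.lean`,
typed by abc-iut-L4-t2 / abc-iut-L4-t14; [AbsTopIII] Cor 2.4 (a) as a named theorem).
-/
import Literature.AnabelianGeometry.AbsoluteAnabelian.HolomorphicCores
import Literature.Geometry.Kaehler.RiemannSurfaceUniversalCover
import Literature.Topology.CoveringSpaces.CoveringDeckTransformations
import Literature.Topology.CoveringSpaces.CoveringDeckGroupAction
import HarnessLib

/-!
# Proof-only companion of `HolomorphicCores`: [AbsTopIII] Cor 2.4 (a), `π₁(X^top) = Aut(U^top/X^top)`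

S. Mochizuki, *Topics in absolute anabelian geometry III*, Cor 2.4 (a) (kurims p.54): «Let
`U^top → X^top` be any universal covering of `X^top` [i.e., a connected covering space of the topological
space `X^top` which does not admit any nontrivial connected covering spaces].  Then one may construct
the fundamental group `π₁(X^top)` as the group of automorphisms `Aut(U^top/X^top)` of `U^top` over
`X^top`.»  The statement file records `Aut(U^top/X^top)` as the honest definition `deckGroup p`; the
identification with `π₁` was available in the tree only through Hatcher's Prop. 1.39/1.40
(`Literature.Topology.CoveringSpaces`).  This file NAMES it at print's generality:

* `nonempty_fundamentalGroup_mulEquiv_deckGroup` — for ANY covering map `p : U → X` from a simply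
  connected, locally path connected `U` («any universal covering») and any base point `u₀`,
  `π₁(X^top, p u₀) ≅ Aut(U^top/X^top)` (Hatcher Prop. 1.39 (b) with `p_* π₁(U) = 1`);
* `nonempty_fundamentalGroup_mulEquiv_deckGroup_universalCover` — the same at Hatcher's model
  `X̃ = UniversalCover X x₀` of a connected space charted over `ℂ` (Prop. 1.40 (b)).

Stated directly as theorems; no new definitions.  Refereed pre-IUT material (classical covering-space
theory); nothing here bears on the disputed [IUTchIII] Cor. 3.12; no side is taken.
-/

noncomputable section

namespace Literature.AnabelianGeometry.AbsoluteAnabelian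

open _root_.TopologicalSpace _root_.Topology _root_.Set _root_.Function
open scoped _root_.Manifold _root_.ContDiff
open Literature.Topology.CoveringSpaces

universe u

/-- **[AbsTopIII] Cor 2.4 (a) — `π₁(X^top) ≅ Aut(U^top/X^top)` for ANY universal covering.**  For a
covering map `p : U^top → X^top` whose total space is simply connected and locally path connected (a
universal covering: «a connected covering space … which does not admit any nontrivial connected
covering spaces») and any `u₀ ∈ U^top`, the fundamental group `π₁(X^top, p u₀)` is isomorphic to the
deck transformation group `deckGroup p = Aut(U^top/X^top)`.  Proof: `p_* π₁(U^top, u₀)` is trivial, hence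
normal, and `G(U) ≅ π₁(X, x₀)/p_* π₁(U, u₀)` for a normal covering (Hatcher Prop. 1.39 (b),
`nonempty_mulEquiv_quotient_of_normal`).
[cite: MochizukiAbsTopIII2015, Corollary 2.4 (a) p.54] [cite: HatcherAT2002, §1.3 Prop. 1.39] -/
theorem nonempty_fundamentalGroup_mulEquiv_deckGroup {U X : Type u} [TopologicalSpace U]
    [TopologicalSpace X] [SimplyConnectedSpace U] [LocallyPathConnectedSpace U] {p : U → X}
    (hp : IsCoveringMap p) (u₀ : U) :
    Nonempty (FundamentalGroup X (p u₀) ≃* deckGroup p) := by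
  set e₀ : p ⁻¹' {p u₀} := ⟨u₀, rfl⟩ with he₀
  have hbot : (FundamentalGroup.mapOfEq (⟨p, hp.continuous⟩ : C(U, X)) e₀.2).range = ⊥ := by
    refine le_bot_iff.1 fun g hg => ?_
    obtain ⟨a, rfl⟩ := hg
    rw [Subsingleton.elim a 1, map_one]
    exact Subgroup.one_mem _
  have hN : (FundamentalGroup.mapOfEq (⟨p, hp.continuous⟩ : C(U, X)) e₀.2).range.Normal := by
    rw [hbot]; infer_instance
  obtain ⟨e⟩ := CoverDeck.nonempty_mulEquiv_quotient_of_normal hp e₀ hN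
  exact ⟨QuotientGroup.quotientBot.symm.trans
    ((QuotientGroup.quotientMulEquivOfEq hbot).symm.trans e)⟩

/-- **[AbsTopIII] Cor 2.4 (a) at Hatcher's universal cover of a connected Riemann surface**: for `X`
connected and charted over `ℂ` (e.g. a connected Riemann surface) and `x₀ ∈ X`,
`π₁(X^top, x₀) ≅ Aut(X̃/X)` for the universal cover `X̃ = UniversalCover X x₀ → X` (a quotient covering
by the deck action of `π₁`, Hatcher Prop. 1.40 (b)).
[cite: MochizukiAbsTopIII2015, Corollary 2.4 (a) p.54] [cite: HatcherAT2002, §1.3 Prop. 1.40] -/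
theorem nonempty_fundamentalGroup_mulEquiv_deckGroup_universalCover (X : Type u) [TopologicalSpace X]
    [ConnectedSpace X] [ChartedSpace ℂ X] (x₀ : X) :
    Nonempty (FundamentalGroup X x₀ ≃*
      deckGroup (UniversalCover.proj : UniversalCover X x₀ → X)) := by
  haveI := Literature.Geometry.Kaehler.pathConnectedSpace_of_connectedSpace X
  haveI := Literature.Geometry.Kaehler.stronglyLocallyContractibleSpace_of_riemannSurface X
  exact (UniversalCover.isQuotientCoveringMap_proj (X := X)
    (x₀ := x₀)).nonempty_mulEquiv_deckTransformations

end Literature.AnabelianGeometry.AbsoluteAnabelian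

end
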